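import Summits.QuantumFields.BalabanUV.Beta.FP.NestedStepLawTorusInstanceDelta
import Summits.QuantumFields.BalabanUV.Beta.FP.PeriodisedWardOrderZero
import Summits.QuantumFields.BalabanUV.Beta.FP.PeriodisedCoarseWardContact
import Summits.QuantumFields.BalabanUV.Beta.FP.NestedSliceDeadJets

/-!
# `BalabanUV.Beta.FP.NestedStepLawTorusInstanceRows` — road «FP» for binder row D1, ROUTE T, (T-INST-j) ∕ (T-ID): **THE δ-CONSTRAINED TORUS CALL
# (`NestedStepLawTorusInstanceDelta`) WITH leaf-02's TABLE ROWS DISCHARGED BY TERM** — order 0 `a0 a0t` (`Y₀ = Y'₀ := 0`; `PeriodisedWardOrderZero`), order 1 `c1`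
# (the ROOTED border table periodised along the insertion direction `h`, with its explicit ultralocal generator jet `W₁` and coarse jet `D̄₁`;
# `PeriodisedBorderWardContactInstance.torus_c1_vhSAt_weighted`) and `d1` (the coarse insertion table transported by the averaging column,
# `PeriodisedCoarseWardContact.torus_d1_vhSAt_weighted`); THIRTEEN binders of p308750 are now discharged at the torus (`h1 c0 hTW hPW b0 b1 b2 d0 h2` by the
# OWNER ∕ leaf-05 ∕ leaf-06 ∕ gan24-leaf-05, `a0 a0t c1 d1` here); DISPLAYED: the direction `h`, the second-order jets `H₁ H₂ Q₁₂ Q₂₂ W₂ Db₂`, the Ward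
# witnesses `Y₁ Y₂ Y'₁ Y'₂`, the rows `a1 a2 a1t a2t c2 d2`, the namings, the coarse-coarse presentation letters; the FP defect in the conclusion

HONEST DEPENDENCY (page 1, mandatory): continuum YM on T⁴ ⇐ BetaPertH ∧ nine spine estimates (0/9 proved); BetaPertH ⇐ (D1) ∧ (D4) ∧ CAP+tail;
G-an2-4 gates asym, D1 and NE2/3/4.  HONEST FRAMING (cell contract, verbatim): «discharging `BetaPertH` makes Bałaban's UV stability UNCONDITIONAL —
a real constructive-QFT result; it is NOT the continuum limit and NOT the Clay problem.»  ABSOLUTE RULE (cell charter, verbatim): «No internally-minted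
statement may enter as a cited fact. Every hypothesis is either kernel-proved in this package or a verbatim quotation of a PUBLISHED theorem with page
reference. The manuscript(s) under audit are NOT citable for their own disputed steps — they are the thing under adjudication; programme-internal
(2001/route/tribunal) claims are never citable.»  THIS MODULE is [folklore] composition BY NAME (one `exact`): the OWNER d1-p3's
`NestedStepLawTorusInstanceDelta.secondVar_oneShot_nestedStepLaw_torus_delta` fed with leaf-02's three row theorems; no `def`, no `def … : Prop`, nothing cited,
0 sorry; 0 estimates; 0∕4 row-D1 binders; NOT (T-ID) complete (the order-1∕2 Ward rows `a1 a2 (+ᵀ)` need the dictionary's multiplier jets; `c2 d2` need the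
second-order tables; WHICH direction `h` and WHETHER the rooted `vhSAt` ∕ `θ_j·Q₁₀` transport are the literal's are the dictionary's ∕ the OWNER's), NOT SDF,
NOT D1, NOT BetaPertH, NOT continuum, NOT Clay.  «not in print; our bookkeeping».

CONTENT.  §1 **`secondVar_oneShot_nestedStepLaw_torus_rows`**: the Delta's statement with `Q₁₁ W₁ Db₁ Q₂₁` bound by their defining equations (`hQ₁₁ hW₁ hDb₁ hQ₂₁`,
weights `h` on the fine torus bonds; transport weight `θ_j·Q₁₀(a′, b)`, `θ_j = stepScale_{j+1} ∕ (stepScale_j²·#B)`), `Y₀ Y'₀ a0 a0t c1 d1` GONE, `a1 a2 a1t a2t` in their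
`Y₀ = 0` shapes; proof = `subst` + one `exact` of the Delta with `torus_a0_letter`, `torus_a0t_letter`, `torus_c1_vhSAt_weighted`, `torus_d1_vhSAt_weighted` BY TERM.
§2 **`torus_coarse_effForm_mul_tgrad`**: the COARSE sliced order-0 form of the same call kills every coarse torus gauge mode — `S.toBlocks₁₁ * (tgrad M′)∘(fields, g) = 0`
(the call's `hH₀ hQ₁₀ hτ₁ hS` verbatim; leaf-05's `RelInvPeriodisedEffFormCoarse.hId_order_zero_record` then `PeriodisedWardOrderZero.sum_perZ_bhKStepAt_ff_mul_tgrad` on the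
coarse box): the level-`(j+1)` `a0` of leaf-05's self-similar reading (`CoarseJetUnit`) with zero witness.
§3 (v1.2 APPEND, OWNER g18 W-FP-18-4 (ii) WANTED) **`torus_combSlice_mul_Db1_eq_zero`** ∕ **`torus_t1_of_average_dead`**: the NESTED dead-row letter `t1 : τ₂·(Q₁₁W₀ + Q₁₀W₁) = 0`
of `NestedStepLawTransported` AT THE RECORD holds as soon as the direction's linear average vanishes on the coarse comb bonds (`Σ_b Q₁₀ a b · h b = 0` at every coarse
comb bond `a`) — by `c1` (p314580) and leaf-06's `NestedSliceDeadJets.combSliceId_mul_eq_zero_of_vanish_on_dead`; a bare bond insertion does not meet it in general.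
Provenance: D1 formalisation swarm LEAF PROVER 02, unit b2b-balaban-beta-d1-formalise-leaf-02 gen 18, 2026-08-22.  No existing file touched.
-/

noncomputable section

open scoped BigOperators

namespace Summit.QuantumFields.BalabanUV.Beta.FP.NestedStepLawTorusInstanceRows

open Matrix Finset
open Literature.Probability.LatticeModels (Torus.proj)
open Literature.MathematicalPhysics.QuantumFieldTheory.Balaban1983to89
open Literature.MathematicalPhysics.QuantumFieldTheory.Balaban1983to89.Beta
open Literature.MathematicalPhysics.QuantumFieldTheory.Balaban1983to89.Beta.Composition (kkt)
open Literature.MathematicalPhysics.QuantumFieldTheory.Balaban1983to89.Beta.CompositionSingular (effForm flucCov minOp minOpL)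
open Literature.MathematicalPhysics.QuantumFieldTheory.LatticeForm (quo)
open B5Prop11Plancherel (fine)
open B6Lemma24Torus (pbox mem_pbox)
open AffineAveraging (Site box toSite unitVec)
open AveragingHessianKernelsRooted (vhSAt)
open OneStepResolventKernel (Fib)
open Summit.QuantumFields.BalabanUV.Beta.BorderedHessian (bhKStepAt stepScale)
open Summit.QuantumFields.BalabanUV.Beta.D1BFx.LogDetSecondVariation (secondVar)
open Summit.QuantumFields.BalabanUV.Beta.FP.KernelPeriodisationFib (Idx perF)
open Summit.QuantumFields.BalabanUV.Beta.FP.KernelPeriodisationFibLoc (dper)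
open Summit.QuantumFields.BalabanUV.Beta.FP.TorusGaugeCovariance (tdelta tgrad)
open Summit.QuantumFields.BalabanUV.Beta.FP.TorusGaugeCovarianceCoarse (coarsePt tgradBlock)
open Summit.QuantumFields.BalabanUV.Beta.FP.TorusCombRows (Res combRowsT)
open Summit.QuantumFields.BalabanUV.Beta.FP.TorusCombNestedBasis (resBigEquiv)
open Summit.QuantumFields.BalabanUV.Beta.GAN24.FineReadoutCauchyFrame (toSite_mem_range)
open Summit.QuantumFields.BalabanUV.Beta.FP.NestedStepLawTorusInstanceDelta (secondVar_oneShot_nestedStepLaw_torus_delta)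
open Summit.QuantumFields.BalabanUV.Beta.FP.PeriodisedWardOrderZero (torus_a0_letter torus_a0t_letter sum_perZ_bhKStepAt_ff_mul_tgrad)
open Summit.QuantumFields.BalabanUV.Beta.FP.KernelPeriodisationFib (perF_apply)
open Summit.QuantumFields.BalabanUV.Beta.FP.TorusGaugeCovarianceCoarse (coarsePt_coe)
open Summit.QuantumFields.BalabanUV.Beta.FP.NestedStepLawTorusInstance (coarseSlot_injective coarseSlot_range)
open Summit.QuantumFields.BalabanUV.Beta.FP.RelInvPeriodisedEffFormCoarse (hId_order_zero_record)
open Summit.QuantumFields.BalabanUV.Beta.FP.PeriodisedBorderWardContactInstance (torus_c1_vhSAt_weighted)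
open Summit.QuantumFields.BalabanUV.Beta.FP.PeriodisedCoarseWardContact (torus_d1_vhSAt_weighted)

variable {d : ℕ} (M' : Fin (d + 1) → ℕ) [∀ μ, NeZero (M' μ)] {Lc : ℕ} [NeZero Lc] {r r' : Fin (d + 1) → ℕ}

set_option synthInstance.maxSize 1024 in
/-- [folklore] **THE TORUS CALL (δ-constrained, `…Delta`) WITH leaf-02's ROWS DISCHARGED**: order 0 `a0 a0t` (`Y₀ = Y'₀ := 0`, `PeriodisedWardOrderZero`), order 1
`c1` (the rooted border table's periodised insertion along the direction `h`, with its explicit ultralocal generator jet `W₁` and coarse jet `D̄₁`; p314580) and `d1`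
(the coarse insertion table transported by the averaging column, `PeriodisedCoarseWardContact`) BY TERM.  DISPLAYED: the second-order jets `H₁ H₂ Q₁₂ Q₂₂ W₂ Db₂`,
the Ward witnesses `Y₁ Y₂ Y'₁ Y'₂`, the order-1∕2 Ward rows `a1 a2 a1t a2t` (now with `Y₀ = 0`: `a1 : H₁·[D₂|D₁] + H₀·W₁ = 𝔔₀ᵀ·Y₁`), the order-2 insertion rows `c2 d2`,
the namings and the coarse-coarse presentation letters — exactly the Delta's residual minus four rows. -/
theorem secondVar_oneShot_nestedStepLaw_torus_rows (hr : r ∈ box (d + 1) Lc) (hr' : r' ∈ box (d + 1) Lc) (hM' : ∀ i, Lc ∣ M' i) (j : ℕ)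
    {κ : Type*} [Fintype κ] [DecidableEq κ] (pμ' : κ → ↥(pbox M')) (mμ' : κ → Fin (d + 1))
    (hfμ' : Function.Injective (fun a : κ => ((pμ' a, Sum.inr (mμ' a)) : Idx M' (Fib d))))
    (hcoarse' : ∀ (s : ↥(pbox M')) (m : Fin (d + 1)),
      ((s, Sum.inr m) : Idx M' (Fib d)) ∈ Set.range (fun a : κ => ((pμ' a, Sum.inr (mμ' a)) : Idx M' (Fib d))) ↔ Torus.proj Lc (s : Site (d + 1)) = 0)
    -- the torus objects of record, by defining equations
    {H₀ : Matrix (↥(pbox (fine Lc M')) × Fin (d + 1)) (↥(pbox (fine Lc M')) × Fin (d + 1)) ℝ}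
    {Q₁₀ : Matrix (↥(pbox M') × Fin (d + 1)) (↥(pbox (fine Lc M')) × Fin (d + 1)) ℝ}
    {τ₁ : Matrix (Res (toSite r) Lc (fine Lc M')) (↥(pbox (fine Lc M')) × Fin (d + 1)) ℝ}
    {τ₂ : Matrix (Res (toSite r') Lc M') (↥(pbox M') × Fin (d + 1)) ℝ}
    {D₁ : Matrix (↥(pbox (fine Lc M')) × Fin (d + 1)) (Res (toSite r) Lc (fine Lc M')) ℝ}
    {D₂ : Matrix (↥(pbox (fine Lc M')) × Fin (d + 1)) (Res (toSite r') Lc M') ℝ}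
    {Dbar : Matrix (↥(pbox M') × Fin (d + 1)) (Res (toSite r') Lc M') ℝ}
    {P : Matrix (Res (toSite r') Lc M' ⊕ Res (toSite r) Lc (fine Lc M')) (↥(pbox (fine Lc M')) × Fin (d + 1)) ℝ}
    (hH₀ : H₀ = (perF (fine Lc M') (bhKStepAt d (toSite r) Lc j)).submatrix
        (fun b : ↥(pbox (fine Lc M')) × Fin (d + 1) => ((b.1, Sum.inl b.2) : Idx (fine Lc M') (Fib d)))
        (fun b : ↥(pbox (fine Lc M')) × Fin (d + 1) => ((b.1, Sum.inl b.2) : Idx (fine Lc M') (Fib d))))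
    (hQ₁₀ : Q₁₀ = (perF (fine Lc M') (bhKStepAt d (toSite r) Lc j)).submatrix
        (fun a : ↥(pbox M') × Fin (d + 1) => ((coarsePt M' Lc a.1, Sum.inr a.2) : Idx (fine Lc M') (Fib d)))
        (fun b : ↥(pbox (fine Lc M')) × Fin (d + 1) => ((b.1, Sum.inl b.2) : Idx (fine Lc M') (Fib d))))
    (hτ₁ : τ₁ = (combRowsT (toSite r) Lc (fine Lc M')).submatrix id
        (fun b : ↥(pbox (fine Lc M')) × Fin (d + 1) => ((b.1, Sum.inl b.2) : Idx (fine Lc M') (Fib d))))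
    (hτ₂ : τ₂ = (combRowsT (toSite r') Lc M').submatrix id (fun b : ↥(pbox M') × Fin (d + 1) => ((b.1, Sum.inl b.2) : Idx M' (Fib d))))
    (hD₁ : D₁ = (tgrad (fine Lc M')).submatrix (fun b : ↥(pbox (fine Lc M')) × Fin (d + 1) => ((b.1, Sum.inl b.2) : Idx (fine Lc M') (Fib d)))
        (Subtype.val : Res (toSite r) Lc (fine Lc M') → ↥(pbox (fine Lc M'))))
    (hD₂ : D₂ = (tgradBlock M' Lc).submatrix (fun b : ↥(pbox (fine Lc M')) × Fin (d + 1) => ((b.1, Sum.inl b.2) : Idx (fine Lc M') (Fib d)))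
        (Subtype.val : Res (toSite r') Lc M' → ↥(pbox M')))
    (hDbar : Dbar = Matrix.of fun (a : ↥(pbox M') × Fin (d + 1)) (t : Res (toSite r') Lc M') =>
        stepScale d Lc j * (((box (d + 1) Lc).card : ℝ) * tgrad M' (a.1, Sum.inl a.2) t.1))
    (hP : P = (combRowsT ((Lc : ℤ) • toSite r' + toSite r) (Lc * Lc) (fine Lc M')).submatrix
        (resBigEquiv Lc Lc (toSite r) (toSite r') M' (Nat.pos_of_ne_zero (NeZero.ne Lc)) (toSite_mem_range hr)
          (Nat.pos_of_ne_zero (NeZero.ne Lc)) (toSite_mem_range hr')).symm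
        (fun b : ↥(pbox (fine Lc M')) × Fin (d + 1) => ((b.1, Sum.inl b.2) : Idx (fine Lc M') (Fib d))))
    -- the displayed jets: form, averaging (both levels), block covariance, generators (fine and coarse), Ward witnesses
    (H₁ H₂ : Matrix (↥(pbox (fine Lc M')) × Fin (d + 1)) (↥(pbox (fine Lc M')) × Fin (d + 1)) ℝ)
    {Q₂₀ : Matrix κ (↥(pbox M') × Fin (d + 1)) ℝ}
    (hQ₂₀ : Q₂₀ = (perF M' (bhKStepAt d (toSite r') Lc (j + 1))).submatrix (fun a : κ => ((pμ' a, Sum.inr (mμ' a)) : Idx M' (Fib d)))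
        (fun b : ↥(pbox M') × Fin (d + 1) => ((b.1, Sum.inl b.2) : Idx M' (Fib d))))
    -- leaf-02's ORDER-1 ROWS: the insertion direction's components `h` on the fine torus bonds; the first-order border table, generator jet, coarse jet and
    -- transported coarse table along it, by their defining equations (p314580 `torus_c1_vhSAt_weighted`, `PeriodisedCoarseWardContact.torus_d1_vhSAt_weighted`)
    (h : ↥(pbox (fine Lc M')) × Fin (d + 1) → ℝ)
    {Q₁₁ : Matrix (↥(pbox M') × Fin (d + 1)) (↥(pbox (fine Lc M')) × Fin (d + 1)) ℝ}
    (hQ₁₁ : Q₁₁ = ∑ b : ↥(pbox (fine Lc M')) × Fin (d + 1), h b •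
        (perF (fine Lc M') (dper (fine Lc M') (vhSAt (toSite r) d Lc rfl b.2 (b.1 : Site (d + 1))))).submatrix
          (fun a : ↥(pbox M') × Fin (d + 1) => ((coarsePt M' Lc a.1, Sum.inr a.2) : Idx (fine Lc M') (Fib d)))
          (fun b : ↥(pbox (fine Lc M')) × Fin (d + 1) => ((b.1, Sum.inl b.2) : Idx (fine Lc M') (Fib d))))
    {W₁ : Matrix (↥(pbox (fine Lc M')) × Fin (d + 1)) (Res (toSite r') Lc M' ⊕ Res (toSite r) Lc (fine Lc M')) ℝ}
    (hW₁ : W₁ = ∑ b : ↥(pbox (fine Lc M')) × Fin (d + 1), h b •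
        Matrix.of (fun (b' : ↥(pbox (fine Lc M')) × Fin (d + 1)) (e : Res (toSite r') Lc M' ⊕ Res (toSite r) Lc (fine Lc M')) =>
          if b' = b then
            -((((Lc : ℝ) ^ (d + 1) * stepScale d Lc j)⁻¹)
              * Sum.elim (fun t : Res (toSite r') Lc M' => tdelta M' (quo Lc ((b.1 : Site (d + 1)) + unitVec b.2)) t.1)
                  (fun s : Res (toSite r) Lc (fine Lc M') => tdelta (fine Lc M') ((b.1 : Site (d + 1)) + unitVec b.2) s.1) e)
          else 0))
    {Db₁ : Matrix (↥(pbox M') × Fin (d + 1)) (Res (toSite r') Lc M') ℝ}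
    (hDb₁ : Db₁ = ∑ b : ↥(pbox (fine Lc M')) × Fin (d + 1), h b •
        Matrix.of fun (a : ↥(pbox M') × Fin (d + 1)) (t : Res (toSite r') Lc M') =>
          -((((Lc : ℝ) ^ (d + 1) * stepScale d Lc j)⁻¹) * Q₁₀ a b * tdelta M' ((a.1 : Site (d + 1)) + unitVec a.2) t.1))
    {Q₂₁ : Matrix κ (↥(pbox M') × Fin (d + 1)) ℝ}
    (hQ₂₁ : Q₂₁ = ∑ b : ↥(pbox (fine Lc M')) × Fin (d + 1), h b •
        ∑ a' : ↥(pbox M') × Fin (d + 1), (stepScale d Lc (j + 1) / (stepScale d Lc j ^ 2 * ((box (d + 1) Lc).card : ℝ)) * Q₁₀ a' b) •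
          (perF M' (dper M' (vhSAt (toSite r') d Lc rfl a'.2 (a'.1 : Site (d + 1))))).submatrix (fun a : κ => ((pμ' a, Sum.inr (mμ' a)) : Idx M' (Fib d)))
            (fun b : ↥(pbox M') × Fin (d + 1) => ((b.1, Sum.inl b.2) : Idx M' (Fib d))))
    -- the second-order data stay displayed
    (Q₁₂ : Matrix (↥(pbox M') × Fin (d + 1)) (↥(pbox (fine Lc M')) × Fin (d + 1)) ℝ) (Q₂₂ : Matrix κ (↥(pbox M') × Fin (d + 1)) ℝ)
    (W₂ : Matrix (↥(pbox (fine Lc M')) × Fin (d + 1)) (Res (toSite r') Lc M' ⊕ Res (toSite r) Lc (fine Lc M')) ℝ)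
    (Db₂ : Matrix (↥(pbox M') × Fin (d + 1)) (Res (toSite r') Lc M') ℝ)
    (Y₁ Y₂ Y'₁ Y'₂ : Matrix κ (Res (toSite r') Lc M' ⊕ Res (toSite r) Lc (fine Lc M')) ℝ)
    {𝔔₀ 𝔔₁ 𝔔₂ : Matrix κ (↥(pbox (fine Lc M')) × Fin (d + 1)) ℝ}
    (h𝔔₀ : Q₂₀ * Q₁₀ = 𝔔₀) (h𝔔₁ : Q₂₁ * Q₁₀ + Q₂₀ * Q₁₁ = 𝔔₁) (h𝔔₂ : Q₂₂ * Q₁₀ + Q₂₁ * Q₁₁ + (Q₂₁ * Q₁₁ + Q₂₀ * Q₁₂) = 𝔔₂)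
    -- the second-order composite Ward TABLE IDENTITIES (δ-constrained: `𝔎 = H`; p308750's moving shapes, `W₀ := [D₂ | D₁]`) and their transposes
    -- orders 1 and 2 only (order 0 `a0 a0t` DISCHARGED with `Y₀ = Y'₀ = 0`, `PeriodisedWardOrderZero`)
    (a1 : H₁ * fromCols D₂ D₁ + H₀ * W₁ = 𝔔₀ᵀ * Y₁)
    (a2 : H₂ * fromCols D₂ D₁ + (2 : ℝ) • (H₁ * W₁) + H₀ * W₂ = (2 : ℝ) • (𝔔₁ᵀ * Y₁) + 𝔔₀ᵀ * Y₂)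
    (a1t : H₁ᵀ * fromCols D₂ D₁ + H₀ᵀ * W₁ = 𝔔₀ᵀ * Y'₁)
    (a2t : H₂ᵀ * fromCols D₂ D₁ + (2 : ℝ) • (H₁ᵀ * W₁) + H₀ᵀ * W₂ = (2 : ℝ) • (𝔔₁ᵀ * Y'₁) + 𝔔₀ᵀ * Y'₂)
    -- the insertion-table covariance TABLE IDENTITIES (orders 1, 2; leaf-02's jet shapes) and the coarse covariance identities (order 0 discharged)
    -- order 2 only (order 1 `c1 d1` DISCHARGED: p314580, `PeriodisedCoarseWardContact`)
    (c2 : Q₁₂ * fromCols D₂ D₁ + (2 : ℝ) • (Q₁₁ * W₁) + Q₁₀ * W₂ = fromCols Db₂ 0)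
    (d2 : Q₂₂ * Dbar + (2 : ℝ) • (Q₂₁ * Db₁) + Q₂₀ * Db₂ = 0)
    -- block namings and the coarse non-degeneracy
    {Γ : Matrix (↥(pbox (fine Lc M')) × Fin (d + 1)) (↥(pbox (fine Lc M')) × Fin (d + 1)) ℝ}
    {I : Matrix (↥(pbox (fine Lc M')) × Fin (d + 1)) ((↥(pbox M') × Fin (d + 1)) ⊕ Res (toSite r) Lc (fine Lc M')) ℝ}
    {L : Matrix ((↥(pbox M') × Fin (d + 1)) ⊕ Res (toSite r) Lc (fine Lc M')) (↥(pbox (fine Lc M')) × Fin (d + 1)) ℝ}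
    {S : Matrix ((↥(pbox M') × Fin (d + 1)) ⊕ Res (toSite r) Lc (fine Lc M')) ((↥(pbox M') × Fin (d + 1)) ⊕ Res (toSite r) Lc (fine Lc M')) ℝ}
    {B : Matrix ((↥(pbox M') × Fin (d + 1)) ⊕ Res (toSite r) Lc (fine Lc M')) (↥(pbox (fine Lc M')) × Fin (d + 1)) ℝ}
    (hΓ : flucCov H₀ (fromRows Q₁₀ τ₁) = Γ) (hI : minOp H₀ (fromRows Q₁₀ τ₁) = I) (hL : minOpL H₀ (fromRows Q₁₀ τ₁) = L) (hS : effForm H₀ (fromRows Q₁₀ τ₁) = S)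
    (hB : fromRows Q₁₁ (0 : Matrix (Res (toSite r) Lc (fine Lc M')) (↥(pbox (fine Lc M')) × Fin (d + 1)) ℝ) = B) :
    secondVar (kkt H₀ (fromRows 𝔔₀ P))
        (kkt H₁ (fromRows 𝔔₁ (0 : Matrix (Res (toSite r') Lc M' ⊕ Res (toSite r) Lc (fine Lc M')) (↥(pbox (fine Lc M')) × Fin (d + 1)) ℝ)))
        (kkt H₂ (fromRows 𝔔₂ (0 : Matrix (Res (toSite r') Lc M' ⊕ Res (toSite r) Lc (fine Lc M')) (↥(pbox (fine Lc M')) × Fin (d + 1)) ℝ)))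
      = secondVar (kkt H₀ (fromRows Q₁₀ τ₁)) (kkt H₁ B)
            (kkt H₂ (fromRows Q₁₂ (0 : Matrix (Res (toSite r) Lc (fine Lc M')) (↥(pbox (fine Lc M')) × Fin (d + 1)) ℝ)))
        + secondVar
            (kkt S.toBlocks₁₁ (fromRows Q₂₀ τ₂))
            (kkt ((L * H₁ - S * B) * I - L * Bᵀ * S).toBlocks₁₁ (fromRows Q₂₁ (0 : Matrix (Res (toSite r') Lc M') (↥(pbox M') × Fin (d + 1)) ℝ)))
            (kkt (((-((L * H₁ - S * B) * Γ + L * Bᵀ * L) * H₁ + L * H₂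
                      - (((L * H₁ - S * B) * I - L * Bᵀ * S) * B
                          + S * fromRows Q₁₂ (0 : Matrix (Res (toSite r) Lc (fine Lc M')) (↥(pbox (fine Lc M')) × Fin (d + 1)) ℝ))) * I
                    + (L * H₁ - S * B) * (-((Γ * H₁ + I * B) * I - Γ * Bᵀ * S)))
                  - ((-((L * H₁ - S * B) * Γ + L * Bᵀ * L) * Bᵀ
                        + L * (fromRows Q₁₂ (0 : Matrix (Res (toSite r) Lc (fine Lc M')) (↥(pbox (fine Lc M')) × Fin (d + 1)) ℝ))ᵀ) * S
                      + L * Bᵀ * ((L * H₁ - S * B) * I - L * Bᵀ * S))).toBlocks₁₁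
              (fromRows Q₂₂ (0 : Matrix (Res (toSite r') Lc M') (↥(pbox M') × Fin (d + 1)) ℝ)))
        + (2 * secondVar (P * fromCols D₂ D₁) (P * W₁) (P * W₂)
          - 2 * secondVar (fromRows (τ₂ * Q₁₀) τ₁ * fromCols D₂ D₁)
              (fromRows (τ₂ * Q₁₁) (0 : Matrix (Res (toSite r) Lc (fine Lc M')) (↥(pbox (fine Lc M')) × Fin (d + 1)) ℝ) * fromCols D₂ D₁
                + fromRows (τ₂ * Q₁₀) τ₁ * W₁)
              (fromRows (τ₂ * Q₁₂) (0 : Matrix (Res (toSite r) Lc (fine Lc M')) (↥(pbox (fine Lc M')) × Fin (d + 1)) ℝ) * fromCols D₂ D₁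
                + fromRows (τ₂ * Q₁₁) (0 : Matrix (Res (toSite r) Lc (fine Lc M')) (↥(pbox (fine Lc M')) × Fin (d + 1)) ℝ) * W₁
                + (fromRows (τ₂ * Q₁₁) (0 : Matrix (Res (toSite r) Lc (fine Lc M')) (↥(pbox (fine Lc M')) × Fin (d + 1)) ℝ) * W₁
                  + fromRows (τ₂ * Q₁₀) τ₁ * W₂))) := by

  subst hQ₁₁ hW₁ hDb₁ hQ₂₁
  exact secondVar_oneShot_nestedStepLaw_torus_delta M' hr hr' hM' j pμ' mμ' hfμ' hcoarse' hH₀ hQ₁₀ hτ₁ hτ₂ hD₁ hD₂ hDbar hP H₁ H₂ hQ₂₀ _ Q₁₂ _ Q₂₂ _ W₂ _ Db₂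
    0 Y₁ Y₂ 0 Y'₁ Y'₂ h𝔔₀ h𝔔₁ h𝔔₂
    (torus_a0_letter M' hr j hH₀ hD₁ hD₂ 𝔔₀) (by rw [Matrix.mul_zero, zero_add]; exact a1) (by rw [Matrix.mul_zero, zero_add]; exact a2)
    (torus_a0t_letter M' hr j hH₀ hD₁ hD₂ 𝔔₀) (by rw [Matrix.mul_zero, zero_add]; exact a1t) (by rw [Matrix.mul_zero, zero_add]; exact a2t)
    (torus_c1_vhSAt_weighted M' hr j h hQ₁₀ hD₁ hD₂) c2 (torus_d1_vhSAt_weighted M' hr' hM' j pμ' mμ' hQ₂₀ hDbar Q₁₀ h) d2 hΓ hI hL hS hB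

/-! ## §2 The COARSE sliced order-0 form of the torus call kills every coarse torus gauge mode (the level-`(j+1)` `a0`, for free) -/

set_option synthInstance.maxSize 1024 in
/-- [folklore] **THE COARSE SLICED FORM KILLS THE COARSE TORUS GAUGE MODES**: with the torus call's `hH₀ hQ₁₀ hτ₁ hS` VERBATIM (fine box `fine Lc M′`, root `r ∈ box`,
coarse multipliers at `coarsePt`), for ANY coarse root `r′ ∈ box` and ANY column selection `g` of coarse box points,
`S.toBlocks₁₁ * (tgrad M′)∘(fields, g) = 0` — leaf-05's `hId_order_zero_record` (`S₁₁ = (wVH (j+1))⁻¹ •` the level-`(j+1)` field block) then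
`PeriodisedWardOrderZero.sum_perZ_bhKStepAt_ff_mul_tgrad` on the coarse box: the ORDER-0 Ward row of the level-`(j+1)` system in leaf-05's self-similar reading
(`CoarseJetUnit`) holds with zero witness as well. -/
theorem torus_coarse_effForm_mul_tgrad (hr : r ∈ box (d + 1) Lc) (hr' : r' ∈ box (d + 1) Lc) (j : ℕ)
    {H₀ : Matrix (↥(pbox (fine Lc M')) × Fin (d + 1)) (↥(pbox (fine Lc M')) × Fin (d + 1)) ℝ}
    {Q₁₀ : Matrix (↥(pbox M') × Fin (d + 1)) (↥(pbox (fine Lc M')) × Fin (d + 1)) ℝ}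
    {τ₁ : Matrix (Res (toSite r) Lc (fine Lc M')) (↥(pbox (fine Lc M')) × Fin (d + 1)) ℝ}
    (hH₀ : H₀ = (perF (fine Lc M') (bhKStepAt d (toSite r) Lc j)).submatrix
        (fun b : ↥(pbox (fine Lc M')) × Fin (d + 1) => ((b.1, Sum.inl b.2) : Idx (fine Lc M') (Fib d)))
        (fun b : ↥(pbox (fine Lc M')) × Fin (d + 1) => ((b.1, Sum.inl b.2) : Idx (fine Lc M') (Fib d))))
    (hQ₁₀ : Q₁₀ = (perF (fine Lc M') (bhKStepAt d (toSite r) Lc j)).submatrix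
        (fun a : ↥(pbox M') × Fin (d + 1) => ((coarsePt M' Lc a.1, Sum.inr a.2) : Idx (fine Lc M') (Fib d)))
        (fun b : ↥(pbox (fine Lc M')) × Fin (d + 1) => ((b.1, Sum.inl b.2) : Idx (fine Lc M') (Fib d))))
    (hτ₁ : τ₁ = (combRowsT (toSite r) Lc (fine Lc M')).submatrix id
        (fun b : ↥(pbox (fine Lc M')) × Fin (d + 1) => ((b.1, Sum.inl b.2) : Idx (fine Lc M') (Fib d))))
    {S : Matrix ((↥(pbox M') × Fin (d + 1)) ⊕ Res (toSite r) Lc (fine Lc M')) ((↥(pbox M') × Fin (d + 1)) ⊕ Res (toSite r) Lc (fine Lc M')) ℝ}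
    (hS : effForm H₀ (fromRows Q₁₀ τ₁) = S) {γ : Type*} (g : γ → ↥(pbox M')) :
    S.toBlocks₁₁ * (tgrad M').submatrix (fun b : ↥(pbox M') × Fin (d + 1) => ((b.1, Sum.inl b.2) : Idx M' (Fib d))) g = 0 := by
  subst hH₀ hQ₁₀ hτ₁
  rw [← hS, hId_order_zero_record M' hr j r' (coarsePt M' Lc) (coarsePt_coe M' Lc) (coarseSlot_injective M') (coarseSlot_range M'), Matrix.smul_mul]
  ext a c
  rw [Matrix.smul_apply, Matrix.mul_apply, Fintype.sum_prod_type, Matrix.zero_apply]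
  simp only [Matrix.submatrix_apply, perF_apply]
  rw [sum_perZ_bhKStepAt_ff_mul_tgrad M' hr' (j + 1) ((a.1 : ↥(pbox M')) : Site (d + 1)) a.2 (g c), smul_zero]

/-! ## §3 (v1.2 append) The nested dead-row letter `t1` of the OWNER g18's `NestedStepLawTransported` AT THE RECORD: it holds exactly when the direction's
linear average vanishes on the coarse comb bonds (OWNER W-FP-18-4 (ii): WANTED) -/

section DeadRows

open Summit.QuantumFields.BalabanUV.Beta.FP.TorusCombRows (combBondT)
open Summit.QuantumFields.BalabanUV.Beta.FP.NestedSliceDeadJets (combSliceId_mul_eq_zero_of_vanish_on_dead)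

omit [∀ μ, NeZero (M' μ)] [NeZero Lc] in
/-- [folklore] **THE COARSE JET's ROWS DIE WHERE THE DIRECTION's AVERAGE DIES**: for the `h`-weighted coarse jet of record
`D̄₁^{(h)} = Σ_b h b • of (−c·Q₁₀ a b·tdelta M′ (a.1 + e_{a.2}) t̄)` (p314580 ∕ §1's `hDb₁`) and ANY matrix `Q₁₀`, if the direction's linear average
`(Q₁₀ h)(a) = Σ_b Q₁₀ a b · h b` vanishes at every coarse COMB bond `a` (`combBondT (toSite r′) Lc M′ x = (a.1, inl a.2)`), then the coarse comb slice kills it: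
`τ₂ * D̄₁^{(h)} = 0` (`hτ₂` VERBATIM from the torus call; leaf-06's `NestedSliceDeadJets.combSliceId_mul_eq_zero_of_vanish_on_dead`). -/
theorem torus_combSlice_mul_Db1_eq_zero (j : ℕ) (Q₁₀ : Matrix (↥(pbox M') × Fin (d + 1)) (↥(pbox (fine Lc M')) × Fin (d + 1)) ℝ)
    (h : ↥(pbox (fine Lc M')) × Fin (d + 1) → ℝ)
    {τ₂ : Matrix (Res (toSite r') Lc M') (↥(pbox M') × Fin (d + 1)) ℝ}
    (hτ₂ : τ₂ = (combRowsT (toSite r') Lc M').submatrix id (fun b : ↥(pbox M') × Fin (d + 1) => ((b.1, Sum.inl b.2) : Idx M' (Fib d))))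
    (hdead : ∀ (a : ↥(pbox M') × Fin (d + 1)) (x : Res (toSite r') Lc M'),
      combBondT (toSite r') Lc M' x = ((a.1, Sum.inl a.2) : Idx M' (Fib d)) → ∑ b : ↥(pbox (fine Lc M')) × Fin (d + 1), Q₁₀ a b * h b = 0) :
    τ₂ * (∑ b : ↥(pbox (fine Lc M')) × Fin (d + 1), h b •
        Matrix.of fun (a : ↥(pbox M') × Fin (d + 1)) (t : Res (toSite r') Lc M') =>
          -((((Lc : ℝ) ^ (d + 1) * stepScale d Lc j)⁻¹) * Q₁₀ a b * tdelta M' ((a.1 : Site (d + 1)) + unitVec a.2) t.1)) = 0 := by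
  rw [hτ₂]
  refine combSliceId_mul_eq_zero_of_vanish_on_dead _ fun a x hx => ?_
  funext t
  rw [Matrix.sum_apply, Pi.zero_apply]
  simp only [Matrix.smul_apply, Matrix.of_apply, smul_eq_mul]
  have e : ∀ b : ↥(pbox (fine Lc M')) × Fin (d + 1),
      h b * -((((Lc : ℝ) ^ (d + 1) * stepScale d Lc j)⁻¹) * Q₁₀ a b * tdelta M' ((a.1 : Site (d + 1)) + unitVec a.2) t.1)
        = -((((Lc : ℝ) ^ (d + 1) * stepScale d Lc j)⁻¹) * tdelta M' ((a.1 : Site (d + 1)) + unitVec a.2) t.1) * (Q₁₀ a b * h b) := fun b => by ring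
  rw [Finset.sum_congr rfl fun b _ => e b, ← Finset.mul_sum, hdead a x hx, mul_zero]

set_option synthInstance.maxSize 1024 in
/-- [folklore] **`torus_t1_of_average_dead` — THE NESTED DEAD-ROW LETTER `t1` AT THE RECORD** (OWNER g18's `NestedStepLawTransported`, `t1 : τ₂·(Q₁₁W₀ + Q₁₀W₁) = 0`):
with the torus call's `hQ₁₀ hD₁ hD₂ hτ₂` VERBATIM and leaf-02's order-1 objects along the direction `h` (`hQ₁₁ hW₁` as in §1), `t1` HOLDS as soon as the direction's
linear average vanishes on the coarse comb bonds — by `c1` (p314580: `Q₁₁W₀ + Q₁₀W₁ = [D̄₁^{(h)} | 0]`) and `torus_combSlice_mul_Db1_eq_zero`.  A bare bond insertion does NOT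
meet `hdead` in general (X2 INFO-1, journal l.39440): the NESTED chart's direction must be average-coarse-comb-dead. -/
theorem torus_t1_of_average_dead (hr : r ∈ box (d + 1) Lc) (j : ℕ) (h : ↥(pbox (fine Lc M')) × Fin (d + 1) → ℝ)
    {Q₁₀ : Matrix (↥(pbox M') × Fin (d + 1)) (↥(pbox (fine Lc M')) × Fin (d + 1)) ℝ}
    {D₁ : Matrix (↥(pbox (fine Lc M')) × Fin (d + 1)) (Res (toSite r) Lc (fine Lc M')) ℝ}
    {D₂ : Matrix (↥(pbox (fine Lc M')) × Fin (d + 1)) (Res (toSite r') Lc M') ℝ}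
    {τ₂ : Matrix (Res (toSite r') Lc M') (↥(pbox M') × Fin (d + 1)) ℝ}
    (hQ₁₀ : Q₁₀ = (perF (fine Lc M') (bhKStepAt d (toSite r) Lc j)).submatrix
        (fun a : ↥(pbox M') × Fin (d + 1) => ((coarsePt M' Lc a.1, Sum.inr a.2) : Idx (fine Lc M') (Fib d)))
        (fun b : ↥(pbox (fine Lc M')) × Fin (d + 1) => ((b.1, Sum.inl b.2) : Idx (fine Lc M') (Fib d))))
    (hD₁ : D₁ = (tgrad (fine Lc M')).submatrix (fun b : ↥(pbox (fine Lc M')) × Fin (d + 1) => ((b.1, Sum.inl b.2) : Idx (fine Lc M') (Fib d)))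
        (Subtype.val : Res (toSite r) Lc (fine Lc M') → ↥(pbox (fine Lc M'))))
    (hD₂ : D₂ = (tgradBlock M' Lc).submatrix (fun b : ↥(pbox (fine Lc M')) × Fin (d + 1) => ((b.1, Sum.inl b.2) : Idx (fine Lc M') (Fib d)))
        (Subtype.val : Res (toSite r') Lc M' → ↥(pbox M')))
    (hτ₂ : τ₂ = (combRowsT (toSite r') Lc M').submatrix id (fun b : ↥(pbox M') × Fin (d + 1) => ((b.1, Sum.inl b.2) : Idx M' (Fib d))))
    {Q₁₁ : Matrix (↥(pbox M') × Fin (d + 1)) (↥(pbox (fine Lc M')) × Fin (d + 1)) ℝ}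
    (hQ₁₁ : Q₁₁ = ∑ b : ↥(pbox (fine Lc M')) × Fin (d + 1), h b •
        (perF (fine Lc M') (dper (fine Lc M') (vhSAt (toSite r) d Lc rfl b.2 (b.1 : Site (d + 1))))).submatrix
          (fun a : ↥(pbox M') × Fin (d + 1) => ((coarsePt M' Lc a.1, Sum.inr a.2) : Idx (fine Lc M') (Fib d)))
          (fun b : ↥(pbox (fine Lc M')) × Fin (d + 1) => ((b.1, Sum.inl b.2) : Idx (fine Lc M') (Fib d))))
    {W₁ : Matrix (↥(pbox (fine Lc M')) × Fin (d + 1)) (Res (toSite r') Lc M' ⊕ Res (toSite r) Lc (fine Lc M')) ℝ}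
    (hW₁ : W₁ = ∑ b : ↥(pbox (fine Lc M')) × Fin (d + 1), h b •
        Matrix.of (fun (b' : ↥(pbox (fine Lc M')) × Fin (d + 1)) (e : Res (toSite r') Lc M' ⊕ Res (toSite r) Lc (fine Lc M')) =>
          if b' = b then
            -((((Lc : ℝ) ^ (d + 1) * stepScale d Lc j)⁻¹)
              * Sum.elim (fun t : Res (toSite r') Lc M' => tdelta M' (quo Lc ((b.1 : Site (d + 1)) + unitVec b.2)) t.1)
                  (fun s : Res (toSite r) Lc (fine Lc M') => tdelta (fine Lc M') ((b.1 : Site (d + 1)) + unitVec b.2) s.1) e)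
          else 0))
    (hdead : ∀ (a : ↥(pbox M') × Fin (d + 1)) (x : Res (toSite r') Lc M'),
      combBondT (toSite r') Lc M' x = ((a.1, Sum.inl a.2) : Idx M' (Fib d)) → ∑ b : ↥(pbox (fine Lc M')) × Fin (d + 1), Q₁₀ a b * h b = 0) :
    τ₂ * (Q₁₁ * fromCols D₂ D₁ + Q₁₀ * W₁) = 0 := by
  subst hQ₁₁ hW₁
  rw [torus_c1_vhSAt_weighted M' hr j h hQ₁₀ hD₁ hD₂, Matrix.mul_fromCols, torus_combSlice_mul_Db1_eq_zero M' j Q₁₀ h hτ₂ hdead, Matrix.mul_zero,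
    Matrix.fromCols_zero]

end DeadRows

end Summit.QuantumFields.BalabanUV.Beta.FP.NestedStepLawTorusInstanceRows

end
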